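import Mathlib.Probability.Independence.Integration

/-!
# Line `haar-coding` (crux `IR`, stmt-QuantumFields-19354): independence of cylinder observables of a product measure

Route `BalabanLadder`, crux `IR`, line `haar-coding` (ideator ym-ir-idea-4; skeleton `Cruxes/IR/Lines/haar_coding.lean`,
engine stub `stub_codedClustering` = E_cod), pooled prover `ym-ir-line-bsf-p1` (director-ym R366).  Two group-free
probabilistic tools for the engine «Haar-coded ⇒ clustering»:

* §1 `integral_mul_eq_of_dependsOn_disjoint` — on a finite product `ι → X` of copies of a probability measure, two
  bounded measurable observables depending on DISJOINT sets of coordinates are uncorrelated: `∫ f g = ∫ f · ∫ g`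
  (Mathlib: coordinates are independent, `iIndepFun_pi`; disjoint blocks are independent, `iIndepFun.indepFun_finset`;
  a function depending only on a block factors through the restriction to that block).
* §2 `abs_integral_sub_le_of_eq_off` — if two observables bounded by `C` agree off an (arbitrary) exceptional set `E`,
  their integrals differ by at most `2 C · ν(E)`.

Honest framing: plumbing; nothing here bears on the Yang–Mills mass gap (Clay).  R4 of the ladder closes only the
conditional finite-𝕋⁴ rung `BalabanLadder.UV`.
Refs: folklore; Y. Spinka, Ann. Probab. 48 (2020) (finitary codings); line card `Cruxes/IR/Lines/haar_coding.md`.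
-/

set_option autoImplicit false

noncomputable section

open MeasureTheory ProbabilityTheory Function

namespace Summit.QuantumFields.YangMills.Cruxes.IR.HaarCodingEngine

/-! ## §1 Observables of disjoint coordinate blocks are uncorrelated -/

section Indep

variable {ι : Type*} [Fintype ι] [DecidableEq ι] {X : Type*} [MeasurableSpace X] (μ : Measure X)
  [IsProbabilityMeasure μ]

omit [Fintype ι] in
/-- Extension of a block configuration by a fixed background. -/
theorem measurable_extend (S : Finset ι) (x₀ : ι → X) :
    Measurable fun (z : S → X) (i : ι) => if h : i ∈ S then z ⟨i, h⟩ else x₀ i := by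
  refine measurable_pi_lambda _ fun i => ?_
  by_cases h : i ∈ S
  · simp only [h, dite_true]; exact measurable_pi_apply _
  · simp only [h, dite_false]; exact measurable_const

omit [Fintype ι] [MeasurableSpace X] in
/-- A function depending only on the coordinates in `S` factors through the restriction to `S`. -/
theorem eq_comp_restrict_of_dependsOn {f : (ι → X) → ℝ} {S : Finset ι} (hf : DependsOn f (↑S : Set ι))
    (x₀ : ι → X) :
    f = (fun z : S → X => f fun i => if h : i ∈ S then z ⟨i, h⟩ else x₀ i) ∘ fun (a : ι → X) (i : S) => a i := by
  funext a
  simp only [comp_apply]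
  apply hf
  intro i hi
  simp [Finset.mem_coe.1 hi]

/-- **Observables of disjoint coordinate blocks are uncorrelated.**  On `ι → X` with the product of copies of a
probability measure `μ`, if `f` depends only on the coordinates in `S`, `g` only on those in `T`, `S ∩ T = ∅`, and
both are measurable, then `∫ f g = (∫ f)(∫ g)`. -/
theorem integral_mul_eq_of_dependsOn_disjoint {f g : (ι → X) → ℝ} (hfm : Measurable f) (hgm : Measurable g)
    {S T : Set ι} (hf : DependsOn f S) (hg : DependsOn g T) (hST : Disjoint S T) :
    ∫ a, f a * g a ∂(Measure.pi fun _ : ι => μ) =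
      (∫ a, f a ∂(Measure.pi fun _ : ι => μ)) * ∫ a, g a ∂(Measure.pi fun _ : ι => μ) := by
  classical
  set S' : Finset ι := Finset.univ.filter fun i => i ∈ S with hS'
  set T' : Finset ι := Finset.univ.filter fun i => i ∈ T with hT'
  have hSS' : (↑S' : Set ι) = S := by ext i; simp [hS']
  have hTT' : (↑T' : Set ι) = T := by ext i; simp [hT']
  have hdisj : Disjoint S' T' := by
    rw [← Finset.disjoint_coe, hSS', hTT']; exact hST
  -- coordinates are independent; disjoint blocks are independent
  have hind : iIndepFun (fun (i : ι) (a : ι → X) => a i) (Measure.pi fun _ : ι => μ) :=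
    iIndepFun_pi (X := fun _ : ι => (id : X → X)) fun _ => aemeasurable_id
  have hblocks : IndepFun (fun (a : ι → X) (i : S') => a i) (fun (a : ι → X) (i : T') => a i)
      (Measure.pi fun _ : ι => μ) :=
    hind.indepFun_finset S' T' hdisj fun i => measurable_pi_apply i
  -- factor `f`, `g` through the blocks
  obtain ⟨x₀⟩ : Nonempty (ι → X) := by
    haveI : Nonempty X := (MeasureTheory.nonempty_of_isProbabilityMeasure μ)
    exact ⟨fun _ => Classical.arbitrary X⟩
  have hfS : DependsOn f (↑S' : Set ι) := by rw [hSS']; exact hf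
  have hgT : DependsOn g (↑T' : Set ι) := by rw [hTT']; exact hg
  have hf' := eq_comp_restrict_of_dependsOn hfS x₀
  have hg' := eq_comp_restrict_of_dependsOn hgT x₀
  have hφm : Measurable fun z : S' → X => f fun i => if h : i ∈ S' then z ⟨i, h⟩ else x₀ i :=
    hfm.comp (measurable_extend S' x₀)
  have hψm : Measurable fun z : T' → X => g fun i => if h : i ∈ T' then z ⟨i, h⟩ else x₀ i :=
    hgm.comp (measurable_extend T' x₀)
  have hfg : IndepFun f g (Measure.pi fun _ : ι => μ) := by
    rw [hf', hg']
    exact hblocks.comp hφm hψm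
  have h := hfg.integral_mul_eq_mul_integral hfm.aestronglyMeasurable hgm.aestronglyMeasurable
  simpa using h

end Indep

/-! ## §2 Observables agreeing off an exceptional set -/

section Replace

variable {Ω : Type*} [MeasurableSpace Ω] (ν : Measure Ω) [IsFiniteMeasure ν]

/-- **Replacement off an exceptional set.**  If `f, f'` are measurable, bounded by `C`, and agree outside a set `E`
(not necessarily measurable), then `|∫ f − ∫ f'| ≤ 2 C · ν(E)`. -/
theorem abs_integral_sub_le_of_eq_off {f f' : Ω → ℝ} (hf : Measurable f) (hf' : Measurable f') {C : ℝ}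
    (hC0 : 0 ≤ C) (hC : ∀ ω, |f ω| ≤ C) (hC' : ∀ ω, |f' ω| ≤ C) (E : Set Ω)
    (hE : ∀ ω, ω ∉ E → f ω = f' ω) :
    |∫ ω, f ω ∂ν - ∫ ω, f' ω ∂ν| ≤ 2 * C * (ν E).toReal := by
  have hEm : MeasurableSet {ω | f ω ≠ f' ω} := (measurableSet_eq_fun hf hf').compl
  have hsub : {ω | f ω ≠ f' ω} ⊆ E := fun ω hω => by
    by_contra h
    exact hω (hE ω h)
  have hfi : Integrable f ν := Integrable.of_bound hf.aestronglyMeasurable C (ae_of_all _ fun ω => by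
    rw [Real.norm_eq_abs]; exact hC ω)
  have hfi' : Integrable f' ν := Integrable.of_bound hf'.aestronglyMeasurable C (ae_of_all _ fun ω => by
    rw [Real.norm_eq_abs]; exact hC' ω)
  have hpt : ∀ ω, |f ω - f' ω| ≤ {ω | f ω ≠ f' ω}.indicator (fun _ => 2 * C) ω := fun ω => by
    by_cases h : f ω = f' ω
    · have : ω ∉ {ω | f ω ≠ f' ω} := fun h' => h' h
      rw [Set.indicator_of_notMem this]; simp [h]
    · have hmem : ω ∈ {ω | f ω ≠ f' ω} := h
      rw [Set.indicator_of_mem hmem]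
      calc |f ω - f' ω| ≤ |f ω| + |f' ω| := abs_sub _ _
        _ ≤ C + C := add_le_add (hC ω) (hC' ω)
        _ = 2 * C := by ring
  calc |∫ ω, f ω ∂ν - ∫ ω, f' ω ∂ν| = |∫ ω, (f ω - f' ω) ∂ν| := by rw [integral_sub hfi hfi']
    _ ≤ ∫ ω, |f ω - f' ω| ∂ν := abs_integral_le_integral_abs
    _ ≤ ∫ ω, {ω | f ω ≠ f' ω}.indicator (fun _ => 2 * C) ω ∂ν := by
        refine integral_mono_of_nonneg (ae_of_all _ fun ω => abs_nonneg _) ?_ (ae_of_all _ hpt)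
        exact (integrable_const (2 * C)).indicator hEm
    _ = 2 * C * (ν {ω | f ω ≠ f' ω}).toReal := by
        rw [integral_indicator hEm, setIntegral_const, smul_eq_mul, mul_comm]
        rfl
    _ ≤ 2 * C * (ν E).toReal :=
        mul_le_mul_of_nonneg_left (ENNReal.toReal_mono (measure_ne_top ν E) (measure_mono hsub))
          (by positivity)

end Replace

end Summit.QuantumFields.YangMills.Cruxes.IR.HaarCodingEngine

end
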